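import Summits.QuantumFields.YangMills.Theorems.UnitScaleTiltProp7DefectChainFormsT3
import HarnessLib

/-!
# Route `UnitScaleTilt`, crux «MinimiserStabilityRegPr» (stmt-QuantumFields-19200), route-R E′ (A′)-comb, COMB-FLAT COERCIVITY ⟸ (I3′) (★★OWNER RULINGS g29-№17∕№18); (I3′) organised as
# px22 g5's PLAN B «ONE-STEP TELESCOPING OF `δQ`» (`LOCATE-I3-ONESTEP-px22g5.md` ac2baf06, adopted by the lane holder w4-19200 g8 05:54:26Z: P1 w4 · **P2 «OneStepDefect» px21 g6** · P3 px22 · P4 px6):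
# **THE ONE-STEP DEFECT `e := σ − γ` IS GRADIENT-BLIND AND CONSTANT-BLIND** — `σ = linAvg` (the one-step linearised symmetric (0.4) average: centred children, stair legs from the centre child)
# versus the CORNERED one-step letter `γ Y c := (Lᵈ)⁻¹ Σ_{r∈[0,L)ᵈ} segSum Y (emb c₋ + r) c.dir L − (Φ Y c₊ − Φ Y c₋)`, `Φ Y y := (Lᵈ)⁻¹ Σ_r walkSum Y (walk (emb y) (treeWord r))` (cornered tube
# + comb tree legs from the SAME base child `emb`): PLAN B §2–§3's (R1)–(R3) and `e(dg) = 0`, `e(Σ_μ g_μdx_μ) = 0`, by kernel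

Cell `ym3-torus` (HUMAN RULING D-0037, YM ladder rung R3 — YM₃ on T³ is a rung, NOT d = 4, NOT infinite volume, NOT a mass gap, NOT Clay; YM gap NOT proved), width seat
`ym3-torus-px21` (gen 6).  THEOREMS ONLY (0 `def`, 0 `sorry`: the letters `γ`, `Φ`, `e` are written INLINE); `--supports stmt-QuantumFields-19200 --as helper`; count-neutral.
Nothing here is a claim about the stub, the crux or any summit statement.

THE PRINT.  [Balaban1984PropagatorsI] (1.9)∕(1.20) p. 19–20 («`(∂λ)([x, x + n e_μ]) = λ(x + n e_μ) − λ(x)`», `Q_kA^λ = Q_kA − ∂Q′_kλ`); [Balaban1985Averaging] (11) p. 19 (gauge covariance of the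
averages), (62)–(63) p. 28 (the comb functional), (110)–(112) p. 34 (the frame exponent and its linearisation `F̂(y) = Σ_{x∈B(y)} L^{−d} A(Γ_{y,x})`), (124)–(127) pp. 36–37 (the linear parts);
[Balaban1987RG1] (0.3)–(0.4) pp. 252–253 (the symmetric average).  The statement «both one-step averagings reproduce coarse gradients of the SAME sampling» is print's design ((11), (1.20));
this file proves it for the route's two letters and records that their DIFFERENCE therefore kills gradients and constants — the input of PLAN B's fixed-scale lemma (P1, w4 g8).

WHAT IS PROVED (ns `…Theorems.Prop7OneStepDefect`; torus `P : Params`, one level `j → j+1`, `Y : PBond P j → Matrix n n ℂ`, base child `emb c.src`; `dg := fun b ↦ g b.tgt − g b.src`).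
* §1 geometry: `walkEnd_eq_transl_disp` (`walkEnd x w = x + disp w`), `runSite_transl_comm`, `runSite_emb_eq_emb_shift` (`emb c₋ + L e_κ = emb c₊`), `segSum_sub_telescope` ((1.9) for `dg`).
* §2 ★ (R1) `cornerTube_grad` — `(Lᵈ)⁻¹Σ_r segSum dg (emb c₋ + r) κ L = (Lᵈ)⁻¹Σ_r [g(emb c₊ + r) − g(emb c₋ + r)]`; ★ (R3) `cornerFrame_grad` — `Φ dg y = (Lᵈ)⁻¹Σ_r [g(emb y + r) − g(emb y)]`;
  (R2) = lit ✓`linAvg_grad` (`σ dg c = g(emb c₊) − g(emb c₋)`).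
* §3 ★★★ `oneStepDefect_grad` — **`σ dg c − γ dg c = 0`**: the corner samplings cancel because the two letters share the base child (PLAN B §3, three lines).
* §4 ★★ `cornerLetter_dirConst`, ★★★ `oneStepDefect_dirConst` — **`σ X₀ c − γ X₀ c = 0`** on the constant one-forms `X₀ b = g b.dir` (✓p698878's `bondAvg_dirConst`∕`combMean_eq_of_dirConst`∕
  `segSum_dirConst`∕`walkSum_walk_eq_of_dirConst` + lit ✓`linAvg_eq_bondAvg_sub_grad_combMean`).
* §5 `cornerTube_eq_linQ_pull`, `cornerFrame_eq_Fhat_pull` — the cornered letters ARE lit's `linQ L`∕`Fhat L` of the pullback at the base child (✓p-(i)-A `linQ_pull_eq_boxMean_segSum`,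
  `asum_pull_eq_walkSum_walk`), so that P3's telescope plugs lit ✓`linQIter_succ` and ✓`fderiv_frameTw_one_apply` (the comb product `Πγ_j`).
HONEST SCOPE.  One-step identities at a torus level; the SUPPORT∕box row of PLAN B §3 and the fixed-scale bound (P1), the telescope (P3) and the slice bound (P4) are the other pens';
nothing of (I3′)∕COMB-FLAT∕A6ᶜ∕N06∕the crux; nothing continuum ∕ OS ∕ mass-gap ∕ Clay.

References: T. Bałaban, CMP **95** (1984) 17–40 [Balaban1984PropagatorsI] ((1.8)–(1.20) pp.19–20); CMP **98** (1985) 17–51 [Balaban1985Averaging] ((11) p.19, (62)–(63) p.28, (110)–(112) p.34,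
(124)–(127) pp.36–37); CMP **109** (1987) 249–301 [Balaban1987RG1] ((0.3)–(0.4) pp.252–253).
-/

set_option autoImplicit false

noncomputable section

open scoped Matrix.Norms.L2Operator BigOperators

namespace Summit.QuantumFields.YangMills.Theorems.Prop7OneStepDefect

open Literature.MathematicalPhysics.QuantumFieldTheory.Balaban1983to89
open B7Prop1Explicit renaming Site → LSite
open B7Prop1Explicit (asum boxVec treeWord disp disp_treeWord e)
open B7Prop3Flat (Fhat linQ)
open B10Eq27TorusAxialLog (transl transl_apply transl_add transl_add_e transl_sub_e transl_zero)
open T4Continuum BlockAveraging LatticeFieldCalculus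
open BlockAveragingEMLLinearised (walkSum walkSum_cons linAvg combMean walkSum_grad linAvg_grad linAvg_eq_bondAvg_sub_grad_combMean)
open Summit.QuantumFields.YangMills.Theorems.Prop7QTwFlatConstantForms (bondAvg_dirConst combMean_eq_of_dirConst segSum_dirConst walkSum_walk_eq_of_dirConst)
open Summit.QuantumFields.YangMills.Theorems.Prop7DefectChainForms (asum_pull_eq_walkSum_walk linQ_pull_eq_boxMean_segSum transl_add_natSmul_e_eq_runSite)

variable {P : Params} {j : ℕ}

/-! ## §1 Geometry of the base child, the straight contours and the walks -/

/-- The walk spelled by `w` from `x` ends at `x + disp w`. [cite: Balaban1985Averaging, (9) p.18] -/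
theorem walkEnd_eq_transl_disp : ∀ (x : Site P j) (w : List (B7Prop1Explicit.Letter P.d)), walkEnd x w = transl x (disp w)
  | x, [] => by simp [walkEnd]
  | x, (μ, true) :: w => by
    rw [B7Prop1Explicit.disp_cons, B7Prop1Explicit.Letter.vec_true, transl_add,
      show transl x (e μ) = x.shift μ by rw [← zero_add (e μ), transl_add_e, transl_zero]]
    exact walkEnd_eq_transl_disp (x.shift μ) w
  | x, (μ, false) :: w => by
    rw [B7Prop1Explicit.disp_cons, B7Prop1Explicit.Letter.vec_false, transl_add,
      show transl x (-e μ) = x.unshift μ by rw [← zero_sub (e μ), transl_sub_e, transl_zero]]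
    exact walkEnd_eq_transl_disp (x.unshift μ) w

/-- Straight contours commute with translations by integer vectors. [cite: Balaban1984PropagatorsI, (1.7) p.18] -/
theorem runSite_transl_comm (x : Site P j) (z : LSite P.d) (κ : Fin P.d) (t : ℕ) : runSite (transl x z) κ t = transl (runSite x κ t) z := by
  funext ν
  simp only [runSite, transl_apply, Function.update_apply]
  split_ifs with hν
  · subst hν; ring
  · rfl

/-- The base children of the two ends of a coarse bond: `emb c₋ + L e_κ = emb c₊` (`c₊ = c₋ + e_κ` on the coarse lattice). [cite: Balaban1985Averaging, (42) p.24] -/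
theorem runSite_emb_eq_emb_shift (y : Site P (j + 1)) (κ : Fin P.d) : runSite (emb y) κ P.L = emb (y.shift κ) := by
  funext ν
  rw [emb_shift_apply]
  simp only [runSite, Function.update_apply]
  split_ifs with hν
  · subst hν; rfl
  · simp

variable {V : Type*} [AddCommGroup V]

/-- (1.9) for the gradient letter `dg b = g(b₊) − g(b₋)`: `segSum dg x μ n = g(x + n e_μ) − g(x)`. [cite: Balaban1984PropagatorsI, (1.9) p.19] -/
theorem segSum_sub_telescope (g : Site P j → V) (x : Site P j) (μ : Fin P.d) :
    ∀ n : ℕ, segSum (fun b : PBond P j => g b.tgt - g b.src) x μ n = g (runSite x μ n) - g x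
  | 0 => by simp [segSum]
  | n + 1 => by
    have ih := segSum_sub_telescope g x μ n
    unfold segSum at ih ⊢
    rw [Finset.sum_range_succ, ih]
    show g (runSite x μ n) - g x + (g (runBond x μ n).tgt - g (runBond x μ n).src) = g (runSite x μ (n + 1)) - g x
    rw [show (runBond x μ n).tgt = runSite x μ (n + 1) by rw [runSite_succ]; rfl, show (runBond x μ n).src = runSite x μ n from rfl]
    abel

/-! ## §2 (R1) and (R3): the cornered letters on a gradient -/

section Rules

variable {n : Type*}

/-- ★ **(R1) THE CORNERED TUBE OF A GRADIENT**: `(Lᵈ)⁻¹ Σ_{r∈[0,L)ᵈ} segSum dg (emb c₋ + r) κ L = (Lᵈ)⁻¹ Σ_r [g(emb c₊ + r) − g(emb c₋ + r)]` — the straight contours telescope and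
`(emb c₋ + r) + L e_κ = emb c₊ + r`. [cite: Balaban1984PropagatorsI, (1.9) p.19, (1.20) p.20] -/
theorem cornerTube_grad (g : Site P j → Matrix n n ℂ) (c : PBond P (j + 1)) :
    ((((P.L : ℝ)) ^ P.d)⁻¹) • ∑ r : Fin P.d → Fin P.L, segSum (fun b : PBond P j => g b.tgt - g b.src) (transl (emb c.src) (boxVec P.L r)) c.dir P.L
      = ((((P.L : ℝ)) ^ P.d)⁻¹) • ∑ r : Fin P.d → Fin P.L, (g (transl (emb c.tgt) (boxVec P.L r)) - g (transl (emb c.src) (boxVec P.L r))) := by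
  congr 1
  refine Finset.sum_congr rfl fun r _ => ?_
  rw [segSum_sub_telescope, runSite_transl_comm, runSite_emb_eq_emb_shift]
  rfl

/-- ★ **(R3) THE CORNERED FRAME LETTER OF A GRADIENT**: `Φ dg y = (Lᵈ)⁻¹ Σ_r [g(emb y + r) − g(emb y)]` — the tree contours telescope (`walkSum_grad`), `Γ_{0,r}` ends at `r`.
[cite: Balaban1985Averaging, (111)–(112) p.34, (11) p.19] -/
theorem cornerFrame_grad (g : Site P j → Matrix n n ℂ) (y : Site P (j + 1)) :
    ((((P.L : ℝ)) ^ P.d)⁻¹) • ∑ r : Fin P.d → Fin P.L, walkSum (fun b : PBond P j => g b.tgt - g b.src) (walk (emb y) (treeWord (boxVec P.L r)))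
      = ((((P.L : ℝ)) ^ P.d)⁻¹) • ∑ r : Fin P.d → Fin P.L, (g (transl (emb y) (boxVec P.L r)) - g (emb y)) := by
  congr 1
  refine Finset.sum_congr rfl fun r _ => ?_
  rw [walkSum_grad, walkEnd_eq_transl_disp, disp_treeWord]

end Rules

/-! ## §3 ★★★ The one-step defect kills gradients -/

section Defect

variable {n : Type*}

/-- ★★★ **THE ONE-STEP DEFECT IS GRADIENT-BLIND** (PLAN B §3): for every coarse gauge parameter `g` and coarse bond `c`,
`σ dg c − γ dg c = 0`, where `σ = linAvg` ((R2): `σ dg c = g(emb c₊) − g(emb c₋)`, lit ✓`linAvg_grad`) and `γ` is the cornered letter with the SAME base child — by (R1)∕(R3) the corner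
samplings `(Lᵈ)⁻¹Σ_r g(emb c± + r)` cancel and `γ dg c = g(emb c₊) − g(emb c₋)` as well. [cite: Balaban1985Averaging, (11) p.19, (124)–(125) p.36; Balaban1984PropagatorsI, (1.20) p.20] -/
theorem oneStepDefect_grad (g : Site P j → Matrix n n ℂ) (c : PBond P (j + 1)) :
    linAvg (fun b : PBond P j => g b.tgt - g b.src) c
      - ( ((((P.L : ℝ)) ^ P.d)⁻¹) • ∑ r : Fin P.d → Fin P.L, segSum (fun b : PBond P j => g b.tgt - g b.src) (transl (emb c.src) (boxVec P.L r)) c.dir P.L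
          - ( ((((P.L : ℝ)) ^ P.d)⁻¹) • ∑ r : Fin P.d → Fin P.L, walkSum (fun b : PBond P j => g b.tgt - g b.src) (walk (emb c.tgt) (treeWord (boxVec P.L r)))
            - ((((P.L : ℝ)) ^ P.d)⁻¹) • ∑ r : Fin P.d → Fin P.L, walkSum (fun b : PBond P j => g b.tgt - g b.src) (walk (emb c.src) (treeWord (boxVec P.L r))) ) )
      = 0 := by
  rw [linAvg_grad, cornerTube_grad, cornerFrame_grad, cornerFrame_grad]
  -- `(Lᵈ)⁻¹ Σ_r [g(c₊ + r) − g(c₋ + r)] − (Lᵈ)⁻¹ Σ_r [g(c₊ + r) − g c₊] + (Lᵈ)⁻¹ Σ_r [g(c₋ + r) − g c₋] = g c₊ − g c₋`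
  have hL : ((P.L : ℝ) ^ P.d) ≠ 0 := pow_ne_zero _ (Nat.cast_ne_zero.mpr P.L_pos.ne')
  have hconst : ∀ v : Matrix n n ℂ, ((((P.L : ℝ)) ^ P.d)⁻¹) • ∑ _r : Fin P.d → Fin P.L, v = v := fun v => by
    rw [Finset.sum_const, Finset.card_univ, Fintype.card_fun, Fintype.card_fin, Fintype.card_fin, ← Nat.cast_smul_eq_nsmul ℝ, smul_smul, Nat.cast_pow, inv_mul_cancel₀ hL, one_smul]
  have key : ((((P.L : ℝ)) ^ P.d)⁻¹) • ∑ r : Fin P.d → Fin P.L, (g (transl (emb c.tgt) (boxVec P.L r)) - g (transl (emb c.src) (boxVec P.L r)))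
      - ( ((((P.L : ℝ)) ^ P.d)⁻¹) • ∑ r : Fin P.d → Fin P.L, (g (transl (emb c.tgt) (boxVec P.L r)) - g (emb c.tgt))
          - ((((P.L : ℝ)) ^ P.d)⁻¹) • ∑ r : Fin P.d → Fin P.L, (g (transl (emb c.src) (boxVec P.L r)) - g (emb c.src)) )
      = g (emb c.tgt) - g (emb c.src) := by
    rw [← hconst (g (emb c.tgt) - g (emb c.src)), ← smul_sub, ← smul_sub, ← Finset.sum_sub_distrib, ← Finset.sum_sub_distrib]
    congr 1
    refine Finset.sum_congr rfl fun r _ => ?_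
    abel
  rw [key, sub_self]

/-! ## §4 ★★ The one-step defect kills the constant one-forms -/

/-- ★★ **THE CORNERED LETTER ON A CONSTANT ONE-FORM**: `γ X₀ c = (L : ℂ) • g c.dir` for `X₀ b = g b.dir` (the tube gives `L` copies of `g κ`; `Φ X₀` is `y`-independent).
[cite: Balaban1984PropagatorsI, (1.15) p.19; Balaban1985Averaging, (112) p.34] -/
theorem cornerLetter_dirConst (g : Fin P.d → Matrix n n ℂ) (c : PBond P (j + 1)) :
    ((((P.L : ℝ)) ^ P.d)⁻¹) • ∑ r : Fin P.d → Fin P.L, segSum (fun b : PBond P j => g b.dir) (transl (emb c.src) (boxVec P.L r)) c.dir P.L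
        - ( ((((P.L : ℝ)) ^ P.d)⁻¹) • ∑ r : Fin P.d → Fin P.L, walkSum (fun b : PBond P j => g b.dir) (walk (emb c.tgt) (treeWord (boxVec P.L r)))
          - ((((P.L : ℝ)) ^ P.d)⁻¹) • ∑ r : Fin P.d → Fin P.L, walkSum (fun b : PBond P j => g b.dir) (walk (emb c.src) (treeWord (boxVec P.L r))) )
      = ((P.L : ℕ) : ℂ) • g c.dir := by
  have hL : ((P.L : ℝ) ^ P.d) ≠ 0 := pow_ne_zero _ (Nat.cast_ne_zero.mpr P.L_pos.ne')
  have hΦ : ∑ r : Fin P.d → Fin P.L, walkSum (fun b : PBond P j => g b.dir) (walk (emb c.tgt) (treeWord (boxVec P.L r)))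
      = ∑ r : Fin P.d → Fin P.L, walkSum (fun b : PBond P j => g b.dir) (walk (emb c.src) (treeWord (boxVec P.L r))) :=
    Finset.sum_congr rfl fun r _ => walkSum_walk_eq_of_dirConst g _ _ _
  rw [hΦ, sub_self, sub_zero]
  simp only [segSum_dirConst]
  rw [Finset.sum_const, Finset.card_univ, Fintype.card_fun, Fintype.card_fin, Fintype.card_fin, smul_smul, ← Nat.cast_smul_eq_nsmul ℝ, smul_smul,
    show ((P.L : ℝ) ^ P.d)⁻¹ * ((P.L ^ P.d * P.L : ℕ) : ℝ) = (P.L : ℝ) by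
      rw [Nat.cast_mul, Nat.cast_pow, ← mul_assoc, inv_mul_cancel₀ hL, one_mul],
    ← Complex.coe_smul]
  norm_cast

/-- ★★★ **THE ONE-STEP DEFECT IS CONSTANT-BLIND**: `σ X₀ c − γ X₀ c = 0` on every constant one-form `X₀ b = g b.dir` — `σ X₀ c = L • g c.dir` by lit
✓`linAvg_eq_bondAvg_sub_grad_combMean` with ✓`bondAvg_dirConst`∕✓`combMean_eq_of_dirConst`, and §4's `γ X₀ c = L • g c.dir`. [cite: Balaban1984PropagatorsI, (1.15) p.19; Balaban1985Averaging, (124)–(125) p.36] -/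
theorem oneStepDefect_dirConst (g : Fin P.d → Matrix n n ℂ) (c : PBond P (j + 1)) :
    linAvg (fun b : PBond P j => g b.dir) c
      - ( ((((P.L : ℝ)) ^ P.d)⁻¹) • ∑ r : Fin P.d → Fin P.L, segSum (fun b : PBond P j => g b.dir) (transl (emb c.src) (boxVec P.L r)) c.dir P.L
          - ( ((((P.L : ℝ)) ^ P.d)⁻¹) • ∑ r : Fin P.d → Fin P.L, walkSum (fun b : PBond P j => g b.dir) (walk (emb c.tgt) (treeWord (boxVec P.L r)))
            - ((((P.L : ℝ)) ^ P.d)⁻¹) • ∑ r : Fin P.d → Fin P.L, walkSum (fun b : PBond P j => g b.dir) (walk (emb c.src) (treeWord (boxVec P.L r))) ) )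
      = 0 := by
  rw [cornerLetter_dirConst, linAvg_eq_bondAvg_sub_grad_combMean, bondAvg_dirConst, combMean_eq_of_dirConst g c.tgt c.src, sub_self, sub_zero, sub_self]

end Defect

/-! ## §5 The cornered letters are lit's `linQ L` ∕ `Fhat L` of the pullback at the base child (for P3's telescope) -/

section Dictionary

variable {n : Type*} [Fintype n] [DecidableEq n]

/-- ★ **THE CORNERED TUBE IS lit's ONE-BLOCK LINEAR AVERAGE (125) OF THE PULLBACK AT THE BASE CHILD**: `(Lᵈ)⁻¹Σ_r segSum Y (emb c₋ + r) κ L = linQ L Y♯_{emb c₋} 0 κ`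
(✓`linQ_pull_eq_boxMean_segSum` at `p = 0`). [cite: Balaban1985Averaging, (125) p.36; Balaban1984PropagatorsI, (1.11) p.19] -/
theorem cornerTube_eq_linQ_pull (Y : PBond P j → Matrix n n ℂ) (c : PBond P (j + 1)) :
    ((((P.L : ℝ)) ^ P.d)⁻¹) • ∑ r : Fin P.d → Fin P.L, segSum Y (transl (emb c.src) (boxVec P.L r)) c.dir P.L
      = linQ P.L (fun (z : LSite P.d) (κ : Fin P.d) => Y ⟨transl (emb c.src) z, κ⟩) 0 c.dir := by
  rw [linQ_pull_eq_boxMean_segSum, Finset.smul_sum]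
  simp only [zero_add]

/-- ★ **THE CORNERED FRAME LETTER IS lit's `F̂` (112) OF THE PULLBACK AT THE BASE CHILD**: `Φ Y y = Fhat L Y♯_{emb y} 0` (✓`asum_pull_eq_walkSum_walk`).
[cite: Balaban1985Averaging, (112) p.34] -/
theorem cornerFrame_eq_Fhat_pull (Y : PBond P j → Matrix n n ℂ) (y : Site P (j + 1)) :
    ((((P.L : ℝ)) ^ P.d)⁻¹) • ∑ r : Fin P.d → Fin P.L, walkSum Y (walk (emb y) (treeWord (boxVec P.L r)))
      = Fhat P.L (fun (z : LSite P.d) (κ : Fin P.d) => Y ⟨transl (emb y) z, κ⟩) 0 := by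
  unfold Fhat
  rw [Finset.smul_sum]
  refine Finset.sum_congr rfl fun r _ => ?_
  rw [asum_pull_eq_walkSum_walk, transl_zero]

end Dictionary

end Summit.QuantumFields.YangMills.Theorems.Prop7OneStepDefect

end
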